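import Summits.NavierStokesRegularity.NavierStokesRegularity.Theorems.StrainDoorsDirectionDoorK5
import Summits.NavierStokesRegularity.NavierStokesRegularity.Theorems.StrainDoorsOneSliceLiouville
import HarnessLib

/-!
# StrainDoorsDirectionDoorK5Endpoint — PART M §M19–§M20: THE `θ = 0` ENDPOINT OF DOOR K5 IS A THEOREM, AND THE
# QUANTITATIVE DOOR K5′ WITH ITS TWO TYPED INPUTS

nsreg-p1 g37, ROUND-65 (helper lane of `stmt-NavierStokesRegularity-0056`, rung N0; 0 ledger writes by the
planner — text for the S-lane to land `--supports stmt-NavierStokesRegularity-0056 --as helper`; tree file 2 of 2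
of ROUND-65; imports ROUND-64's `StrainDoorsDirectionDoorK5` (text H) and ROUND-65's `StrainDoorsOneSliceLiouville`).

## What is proved (sorry-free, std axioms)

§M19 ★★★ `peakDirectionSpread_zero : 0 < R → PeakDirectionSpread C₀ 0 R 0` and
`peakDirectionSpreadRel_zero : 0 < R → μ < 1 → PeakDirectionSpreadRel C₀ 0 R μ` — the doors K-ε / K-ε′ of
ROUND-64 at the opening angle `θ = 0` HOLD, for EVERY range `R > 0`: no Type-I tangent peak has a locally constant
vorticity direction on the part of `B(z̄, R/2)` carrying vorticity above `μ × (peak height)`.  One slice (the record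
time `−1`), one open set, no singular point: the one-slice Liouville theorem of `StrainDoorsOneSliceLiouville`
(§M18) applied to the shifted peak (`IsTypeITangentPeak.exists_vorticityDirection_ne`).  The general form is
`IsTypeITangentPeak.exists_direction_spread` (any threshold `m` below the peak height).  Through the KERNEL-CHECKED
REDUCTIONS of text H this closes door K5 at its endpoint on the `u`-side:
`eq_zero_of_typeI_of_directionCoherence_zero`, `eq_zero_of_typeI_of_relDirectionCoherence_zero` (a classical Type-I
ancient solution whose high-vorticity directions are locally CONSTANT at parabolic scale at every time vanishes) —
which is Giga–Miura's Prop. 2.2 / the tree's `unidirectionalVorticityLiouville` for this class, here localised.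

§M20 The QUANTITATIVE door K5′ `PeakDirectionSpreadFloor C₀ R μ := ∃ δ > 0, PeakDirectionSpreadRel C₀ δ R μ`
(«peaks are UNIFORMLY non-unidirectional: a positive direction spread `δ(C₀,R,μ)`»), NOT proved; its kernel-checked
consequence `exists_pos_coherence_liouville_of_floor` («∃ δ > 0: relative `δ`-coherence over `R` parabolic units ⇒
`u ≡ 0`» — a Giga–Miura/Barker–Prange criterion with a FIXED small oscillation instead of a modulus of
continuity); monotonicity in `θ`; and the two TYPED INPUTS of the compactness proof of K5′:
(P1) `SmallVorticityNumberLiouville` («∀ C, ∃ η(C) > 0: `u ∈ A_C` with `sup (0−s)|ω| ≤ η` ⇒ `u ≡ 0`») with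
its kernel-checked consequences `peak_height_floor_of_smallVorticityNumberLiouville` (every peak of `A_{C₀}`-type
has height `> η(C₀)`) and `peakDirectionSpread_zero_of_lt_floor` (the ABSOLUTE door at `θ = 0` for all thresholds
`m ≤ η(C₀)`);
(P2) `TypeIAncientCompactness C` (sequential compactness of `A_C` under pointwise convergence of fields and curls).

Sources: [GigaMiura2011, Thm 1.1 / Prop 2.2]; [BarkerPrange2020Alignment = arXiv:1906.08225, Thm 3, Prop 4, Rem 15];
[KochNadirashviliSereginSverak2009, Thm 5.1/6.2]; [ConstantinFefferman1993, §1]; arXiv:2501.08976 Thm 1.1.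
[new-as-typed]
-/

noncomputable section

open MeasureTheory Set Function Filter Metric Real InnerProductSpace
open _root_.Topology
open scoped ENNReal NNReal RealInnerProductSpace ContDiff
open Literature.Analysis Literature.Analysis.FluidPDE
open Literature.Analysis.FluidPDE.VorticityDirectionDynamics

set_option linter.dupNamespace false

namespace Summit.NavierStokesRegularity.NavierStokesRegularity.Theorems.StrainDoors

/-! ### §M19 The `θ = 0` endpoint of door K5 -/

/-- ★★★ **Direction spread of a peak at every threshold below its height.**  For a Type-I tangent peak `(v̄, z̄)`,
every `m < |ω̄(-1,z̄)|` and every `R > 0` there are two points `y, y'` with `|ω̄(-1)| > m` at both, `‖y' − y‖ ≤ R`,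
and DIFFERENT vorticity directions (in fact `y = z̄`, `y' ∈ B(z̄, R/2)`).  Proof: the set
`B(z̄,R/2) ∩ {|ω̄(-1)| > m}` is open and contains `z̄`; apply `IsTypeITangentPeak.exists_vorticityDirection_ne`
(§M18 on the shifted peak). [cite: GigaMiura2011, Prop. 2.2; BarkerPrange2020Alignment, Prop. 4 (arXiv:1906.08225 p. 5)] -/
theorem IsTypeITangentPeak.exists_direction_spread {C₀ : ℝ}
    {v : ℝ → EuclideanSpace ℝ (Fin 3) → EuclideanSpace ℝ (Fin 3)} {zbar : EuclideanSpace ℝ (Fin 3)}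
    (hP : IsTypeITangentPeak C₀ v zbar) {m : ℝ} (hm : m < ‖curl (v (-1)) zbar‖) {R : ℝ} (hR : 0 < R) :
    ∃ y y' : EuclideanSpace ℝ (Fin 3), m < ‖curl (v (-1)) y‖ ∧ m < ‖curl (v (-1)) y'‖ ∧ ‖y' - y‖ ≤ R ∧
      0 < ‖vorticityDirection (curl (v (-1))) y' - vorticityDirection (curl (v (-1))) y‖ := by
  have hA := hP.isTypeIAncientMild_shift
  have hcont : Continuous (curl (v (-1))) := by
    have h1 : ContDiff ℝ (⊤ : ℕ∞) ((fun t : ℝ => v (t - 1 / 4)) (-(3 / 4))) := hA.contDiff_slice (by norm_num)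
    simp only [show (-(3 / 4) : ℝ) - 1 / 4 = -1 by norm_num] at h1
    have h2 : ContDiff ℝ 1 (v (-1)) := h1.of_le (by norm_cast)
    exact (contDiff_curl (n := 0) (by exact_mod_cast h2)).continuous
  have hS : IsOpen (ball zbar (R / 2) ∩ {y | m < ‖curl (v (-1)) y‖}) :=
    isOpen_ball.inter (isOpen_lt continuous_const hcont.norm)
  have hz : zbar ∈ ball zbar (R / 2) ∩ {y | m < ‖curl (v (-1)) y‖} := ⟨mem_ball_self (by linarith), hm⟩
  obtain ⟨y, hyS, -, hne⟩ := hP.exists_vorticityDirection_ne hS hz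
  refine ⟨zbar, y, hm, hyS.2, ?_, norm_pos_iff.2 (sub_ne_zero.2 hne)⟩
  have hd : dist y zbar < R / 2 := mem_ball.1 hyS.1
  rw [dist_eq_norm] at hd
  linarith

/-- ★★★ **DOOR K-ε AT `θ = 0` (absolute threshold `m = 0`) HOLDS for every `R > 0`**: every Type-I tangent peak has
two points of non-zero vorticity within `R` of each other with different directions.
[cite: GigaMiura2011, Prop. 2.2; BarkerPrange2020Alignment, Prop. 4 (arXiv:1906.08225 p. 5)] -/
theorem peakDirectionSpread_zero {C₀ R : ℝ} (hR : 0 < R) : PeakDirectionSpread C₀ 0 R 0 :=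
  fun _ _ hP => hP.exists_direction_spread (norm_pos_iff.2 hP.2.2.2.1) hR

/-- ★★★ **DOOR K-ε′ AT `θ = 0` (relative threshold `μ < 1`) HOLDS for every `R > 0`**: every Type-I tangent peak
has two points with vorticity above `μ ×` its height, within `R` of each other, with different directions.
[cite: GigaMiura2011, Prop. 2.2; BarkerPrange2020Alignment, Prop. 4 (arXiv:1906.08225 p. 5)] -/
theorem peakDirectionSpreadRel_zero {C₀ R μ : ℝ} (hR : 0 < R) (hμ : μ < 1) : PeakDirectionSpreadRel C₀ 0 R μ :=
  fun _ _ hP => hP.exists_direction_spread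
    (by have h := norm_pos_iff.2 hP.2.2.2.1; nlinarith) hR

/-- ★★★ **K5 at its endpoint, `u`-side (absolute):** a classical Type-I ancient solution whose vorticity directions
are locally CONSTANT at parabolic scale — equal for any two points of non-zero vorticity at parabolic distance
`≤ R`, at every time — vanishes identically (door `peakDirectionSpread_zero` through the reduction
`eq_zero_of_typeI_of_directionCoherence` of text H).  This is the tree's `unidirectionalVorticityLiouville`
(Giga–Miura Prop. 2.2) for this class, LOCALISED to parabolic balls.
[cite: GigaMiura2011, Prop. 2.2; GigaGuHsu2019, §2.4] -/
theorem eq_zero_of_typeI_of_directionCoherence_zero {C₀ R : ℝ} (hR : 0 < R)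
    {u : ℝ → EuclideanSpace ℝ (Fin 3) → EuclideanSpace ℝ (Fin 3)} {p : ℝ → EuclideanSpace ℝ (Fin 3) → ℝ}
    (hsol : IsClassicalNSSolutionOn (Iio 0) 1 0 u p) (hI : HasTypeIDecay C₀ u)
    (hcoh : ParabolicDirectionCoherence 0 R 0 u) :
    ∀ t : ℝ, t < 0 → ∀ x : EuclideanSpace ℝ (Fin 3), u t x = 0 :=
  eq_zero_of_typeI_of_directionCoherence le_rfl (peakDirectionSpread_zero hR) hsol hI hcoh

/-- ★★★ **K5 at its endpoint, `u`-side (relative):** the same with the hypothesis only on the points of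
scale-invariant vorticity above `μ ×` each dominant, `0 ≤ μ < 1`. [cite: GigaMiura2011, Prop. 2.2] -/
theorem eq_zero_of_typeI_of_relDirectionCoherence_zero {C₀ R μ : ℝ} (hR : 0 < R) (hμ0 : 0 ≤ μ) (hμ1 : μ < 1)
    {u : ℝ → EuclideanSpace ℝ (Fin 3) → EuclideanSpace ℝ (Fin 3)} {p : ℝ → EuclideanSpace ℝ (Fin 3) → ℝ}
    (hsol : IsClassicalNSSolutionOn (Iio 0) 1 0 u p) (hI : HasTypeIDecay C₀ u)
    (hcoh : RelParabolicDirectionCoherence 0 R μ u) :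
    ∀ t : ℝ, t < 0 → ∀ x : EuclideanSpace ℝ (Fin 3), u t x = 0 :=
  eq_zero_of_typeI_of_relDirectionCoherence hμ0 (peakDirectionSpreadRel_zero hR hμ1) hsol hI hcoh

/-! ### §M20 The quantitative door K5′ and its two typed inputs -/

/-- The doors are antitone in the opening angle. -/
theorem PeakDirectionSpreadRel.of_le {C₀ θ θ' R μ : ℝ} (h : PeakDirectionSpreadRel C₀ θ R μ) (hθ : θ' ≤ θ) :
    PeakDirectionSpreadRel C₀ θ' R μ := fun v zbar hP => by
  obtain ⟨y, y', hy, hy', hd, hθ'⟩ := h v zbar hP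
  exact ⟨y, y', hy, hy', hd, hθ.trans_lt hθ'⟩

/-- The doors are antitone in the opening angle (absolute threshold). -/
theorem PeakDirectionSpread.of_le {C₀ θ θ' R m : ℝ} (h : PeakDirectionSpread C₀ θ R m) (hθ : θ' ≤ θ) :
    PeakDirectionSpread C₀ θ' R m := fun v zbar hP => by
  obtain ⟨y, y', hy, hy', hd, hθ'⟩ := h v zbar hP
  exact ⟨y, y', hy, hy', hd, hθ.trans_lt hθ'⟩

/-- door K5′ «PeakDirectionSpreadFloor» `(C₀, R, μ)`: a POSITIVE direction spread — some `δ = δ(C₀,R,μ) > 0` such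
that every Type-I tangent peak has two points within `R` with vorticity above `μ ×` its height whose directions
differ by more than `δ`.  §M19 is the `δ = 0` statement; K5′ is its UNIFORM version over the peak class and is the
typed compactness target (inputs (P1), (P2) below).  Not proved here. [new-as-typed] -/
def PeakDirectionSpreadFloor (C₀ R μ : ℝ) : Prop :=
  ∃ δ : ℝ, 0 < δ ∧ PeakDirectionSpreadRel C₀ δ R μ

/-- ★★ **K5′ ⇒ a direction criterion with a FIXED oscillation allowance** (kernel-checked composition with text H):
if the floor holds then for some `δ > 0`, every classical Type-I ancient solution (constant `C₀`) whose vorticity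
directions are `δ`-coherent over `R` parabolic units on the relatively `μ`-high set vanishes — Giga–Miura's /
Barker–Prange's continuous-alignment criterion with «modulus of continuity» replaced by «oscillation `≤ δ` at ONE
parabolic scale». [cite: GigaMiura2011, Thm 1.1; BarkerPrange2020Alignment, Thm 3 / Rem 15 (arXiv:1906.08225)] -/
theorem exists_pos_coherence_liouville_of_floor {C₀ R μ : ℝ} (hμ : 0 ≤ μ) (h : PeakDirectionSpreadFloor C₀ R μ) :
    ∃ δ : ℝ, 0 < δ ∧
      ∀ (u : ℝ → EuclideanSpace ℝ (Fin 3) → EuclideanSpace ℝ (Fin 3)) (p : ℝ → EuclideanSpace ℝ (Fin 3) → ℝ),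
        IsClassicalNSSolutionOn (Iio 0) 1 0 u p → HasTypeIDecay C₀ u → RelParabolicDirectionCoherence δ R μ u →
        ∀ t : ℝ, t < 0 → ∀ x : EuclideanSpace ℝ (Fin 3), u t x = 0 := by
  obtain ⟨δ, hδ, hK⟩ := h
  exact ⟨δ, hδ, fun u p hsol hI hcoh => eq_zero_of_typeI_of_relDirectionCoherence hμ hK hsol hI hcoh⟩

/-- (P1) «SmallVorticityNumberLiouville»: for every class constant `C` an `η = η(C) > 0` such that every
Type-I ancient mild solution `u ∈ A_C` with scale-invariant vorticity number `sup_{s<0,y} (0 − s)|ω(s,y)| ≤ η`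
vanishes.  (Sketch, not formalised: Duhamel from `−∞` in the class, `u(t) = −∫_{−∞}^t e^{(t−τ)Δ} P∇·G(τ) dτ` with
`G = u ⊗ u − ½|u|² I`, `∇·G = ω × u` (Lamb form); splitting the Oseen kernel at radius `ρ(τ) = A√(0−τ)/η` —
near part against `‖ω × u‖_∞ ≤ ηA(0−τ)^{-3/2}` with the logarithmic bound `∫_{|z|<2ρ}|K_s| ≤ c·log(1 + 2ρ/√s)`, far
part in divergence form against `‖G‖_∞ ≤ (3/2)A²/(0−τ)` — gives for `A := sup √(0−t)‖u(t)‖_∞ ≤ C` the inequality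
`A ≤ c η A (1 + log(1 + A/η))`, absurd for `A > 0` once `c η (1 + log(1 + C/η)) < 1`; the dependence `η(C) ≍
1/log C` is why `η` is NOT typed universal.)  Typed input of K5′; the vorticity analogue of the small-constant
Type-I Liouville theorem.  Not proved here. (cf. Koch–Nadirashvili–Seregin–Šverák 2009, §1 — the small Type-I constant
Liouville theorem — and Thm 5.1; folklore.) [new-as-typed]  (LANDING NOTE, ns-s30-p1 g6: the text's cite tag on this
parameterless `def … : Prop` made the gate RELOCATE it to `Literature/Uncategorized/` as a «named fact» (p715180/p715181, bounced);
it is the round's TYPED INPUT, not a published result — and is proved in the tree, `eq_zero_of_typeIAncientMild_of_small_vorticityNumber`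
— so the tag is spelled out in prose; statement byte-identical.) -/
def SmallVorticityNumberLiouville : Prop :=
  ∀ C : ℝ, ∃ η : ℝ, 0 < η ∧ ∀ u : ℝ → EuclideanSpace ℝ (Fin 3) → EuclideanSpace ℝ (Fin 3),
    IsTypeIAncientMild C u → (∀ s : ℝ, s < 0 → ∀ y : EuclideanSpace ℝ (Fin 3), (0 - s) * ‖curl (u s) y‖ ≤ η) →
      ∀ t : ℝ, t < 0 → ∀ x : EuclideanSpace ℝ (Fin 3), u t x = 0

/-- ★★ **(P1) ⇒ PEAK HEIGHT FLOOR**: every Type-I tangent peak of constant `C₀` has height `|ω̄(-1,z̄)| > η(C₀)`.  The shifted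
peak `w = v̄(· − 1/4) ∈ A_{C₀}` has vorticity number `≤ |ω̄(-1,z̄)|` (`(0 − s)|ω_w(s)| ≤ (1/4 − s)|ω̄(s − 1/4)| ≤ ρ̄`
by the peak's record inequality), so a peak of height `≤ η` would vanish. [cite: GigaMiura2011, §2 (blow-up limits are non-trivial); folklore] -/
theorem peak_height_floor_of_smallVorticityNumberLiouville (h : SmallVorticityNumberLiouville) (C₀ : ℝ) :
    ∃ η : ℝ, 0 < η ∧ ∀ (v : ℝ → EuclideanSpace ℝ (Fin 3) → EuclideanSpace ℝ (Fin 3))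
      (zbar : EuclideanSpace ℝ (Fin 3)), IsTypeITangentPeak C₀ v zbar → η < ‖curl (v (-1)) zbar‖ := by
  obtain ⟨η, hη, hL⟩ := h C₀
  refine ⟨η, hη, fun v zbar hP => ?_⟩
  by_contra hle
  push Not at hle
  have hA := hP.isTypeIAncientMild_shift
  have hrec := hP.2.2.2.2
  have hnum : ∀ s : ℝ, s < 0 → ∀ y : EuclideanSpace ℝ (Fin 3),
      (0 - s) * ‖curl ((fun t : ℝ => v (t - 1 / 4)) s) y‖ ≤ η := by
    intro s hs y
    have h1 := hrec (s - 1 / 4) (by linarith) y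
    have h2 : (0 - s) * ‖curl (v (s - 1 / 4)) y‖ ≤ (0 - (s - 1 / 4)) * ‖curl (v (s - 1 / 4)) y‖ :=
      mul_le_mul_of_nonneg_right (by linarith) (norm_nonneg _)
    have h3 : (0 - (-1 : ℝ)) * ‖curl (v (-1)) zbar‖ = ‖curl (v (-1)) zbar‖ := by norm_num
    linarith [h2.trans h1]
  have h0 := hL _ hA hnum (-(3 / 4)) (by norm_num)
  simp only [show (-(3 / 4) : ℝ) - 1 / 4 = -1 by norm_num] at h0
  have hv : v (-1) = 0 := funext h0
  exact hP.2.2.2.1 (by rw [hv]; exact curl_zero zbar)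

/-- ★★ **(P1) ⇒ THE ABSOLUTE DOOR AT `θ = 0` BELOW THE FLOOR**: for every threshold `m < η` and range `R > 0`,
`PeakDirectionSpread C₀ 0 R m` for `m ≤ η(C₀)` (the absolute door of ROUND-64 at its endpoint, for SMALL POSITIVE thresholds — the
`m = 0` case is `peakDirectionSpread_zero` unconditionally). [cite: GigaMiura2011, Prop. 2.2] -/
theorem peakDirectionSpread_zero_of_lt_floor (h : SmallVorticityNumberLiouville) (C₀ : ℝ) :
    ∃ η : ℝ, 0 < η ∧ ∀ (R m : ℝ), 0 < R → m ≤ η → PeakDirectionSpread C₀ 0 R m := by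
  obtain ⟨η, hη, hfl⟩ := peak_height_floor_of_smallVorticityNumberLiouville h C₀
  exact ⟨η, hη, fun R m hR hm v zbar hP =>
    hP.exists_direction_spread (hm.trans_lt (hfl v zbar hP)) hR⟩

/-- (P2) «TypeIAncientCompactness» `C`: the class `A_C` is sequentially compact under pointwise convergence of
the fields and of their curls on `(-∞,0) × ℝ³` (KNSS 2009 / Seregin–Šverák: uniform `C^k` bounds on
`(-∞,−δ] × ℝ³`, Arzelà–Ascoli, passage to the limit in the Oseen–Duhamel identity; the tree proves the one-orbit
instance `typeI_tangent_field` / `isTypeITangentPeak_of_typeI`).  Typed input of K5′.  Not proved here.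
[cite: KochNadirashviliSereginSverak2009, Thm 5.1 proof; SereginSverak2009TypeI, §3] -/
def TypeIAncientCompactness (C : ℝ) : Prop :=
  ∀ u : ℕ → ℝ → EuclideanSpace ℝ (Fin 3) → EuclideanSpace ℝ (Fin 3), (∀ j, IsTypeIAncientMild C (u j)) →
    ∃ (w : ℝ → EuclideanSpace ℝ (Fin 3) → EuclideanSpace ℝ (Fin 3)) (φ : ℕ → ℕ), StrictMono φ ∧
      IsTypeIAncientMild C w ∧ ∀ t : ℝ, t < 0 → ∀ x : EuclideanSpace ℝ (Fin 3),
        Tendsto (fun j => u (φ j) t x) atTop (𝓝 (w t x)) ∧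
        Tendsto (fun j => curl (u (φ j) t) x) atTop (𝓝 (curl (w t) x))

/-- N1 (typed next statement, ROUND-66 target) «K5FloorReduction»: (P1) and (P2) imply door K5′ for all
`R > 0`, `0 < μ < 1` — by contradiction and compactness: `δ_j → 0`-coherent peaks, recentred at `z̄_j` and shifted,
converge in `A_{C₀}` to a field whose slice at `−3/4` has locally constant direction on the open set
`B(0,R/2) ∩ {|ω| > μ'ρ̄_∞}` (`μ < μ' < 1`, `ρ̄_∞ ≥ η(C₀) > 0` by (P1)), contradicting §M18.  Not proved here. [new-as-typed] -/
def K5FloorReduction : Prop :=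
  SmallVorticityNumberLiouville → (∀ C : ℝ, TypeIAncientCompactness C) →
    ∀ C₀ R μ : ℝ, 0 < R → 0 < μ → μ < 1 → PeakDirectionSpreadFloor C₀ R μ

end Summit.NavierStokesRegularity.NavierStokesRegularity.Theorems.StrainDoors

end
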